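import Summits.ABC.Analytic.RequirementsCongruence
import Summits.ABC.Analytic.RequirementsSharp
import Literature.NumberTheory.EllipticCurves.DegreeConjectureAbcMurtyMinimalModelProofs
import Literature.NumberTheory.EllipticCurves.ModularParametrizationBCDTProofs
import Literature.NumberTheory.EllipticCurves.LFunctionSmulProofs
import Literature.NumberTheory.EllipticCurves.CongruenceNumber
import Literature.NumberTheory.EllipticCurves.CuspFormLFunctionLevelConductorProofs
import Literature.NumberTheory.Automorphic.ShimuraCurveRibetTakahashiOptimalModularityProofs
import Literature.NumberTheory.Automorphic.ShimuraCurveRibetTakahashiSemistableManinProofs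
import HarnessLib
import HarnessLib.Audit

/-!
# ABC — analytic / modular lens: GLUE for the CONGRUENCE-NUMBER rows (R4, R4♯, R9) of the requirements table

Cell `abc-an` (C1), seat `pr-1` (GLUE-CONG); PROOF-ONLY companion of `Summits/ABC/Analytic/Requirements.lean` (file I),
`Summits/ABC/Analytic/RequirementsCongruence.lean` (file II: the row `def`s `PolyCongruenceNumberRat(Eff)`,
`SharpCongruenceNumberRat`, `MurtyPastenConj44` and S3 / S3′ / `abc_of_sharpCongruenceNumberRat`) and of the sub-summit
Prop `Summit.ABC.PolySzpiroRat(Eff)` (`Summits/ABC/Analytic/PolySzpiro.lean`). No definition, no named fact: theorems only,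
every hypothesis a NAMED fact of the tree (or the summit `ABC`, or an OPEN row used as antecedent).

HONESTY: abc is not proved by any of this; **A-PS** (`Summit.ABC.PolySzpiroRat`) is **NOT abc — «NOT abc — POLY-SZPIRO(E)»**
(D-0139/D-0140); «NOT abc; first polynomial bound would supersede Stewart–Yu's exponential». Typed ≠ proved: every row is
an OPEN statement used only as a hypothesis; KNOWN inputs not yet proved in the tree enter BY NAME as hypotheses. The A0
theorems of §B are RESTATEMENT certificates (abc ⟺ a row, modulo named known facts), not progress toward abc.

## What is here
* §A (rung A-PS, EFFECTIVE cells of census rows PS-4 / R9): `polySzpiroRatEff_of_polyCongruenceNumberRatEff`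
  (`R4-Eff(K, C) ⟹ A-PS-Eff(6K, 6 log(163 C) + 24π + 16)`), `exists_polySzpiroRatEff_sharp_of_polyCongruenceNumberRat`
  (`6K − 3 + ε`), `polySzpiroRatEff_of_murtyPastenConj44` (`R9(K, C) ⟹ A-PS-Eff(6K, 6C + 6 log 163 + 24π + 16)`; its
  docstring records the R9-H2 PATH remark: Murty–Pasten 2013 p. 3748 "We do not know if a sufficiently strong version
  of the ABC conjecture implies Conjecture 4.4" — no converse edge exists, none is typed).
* §B (rung A0): `sharpCongruenceNumberRat_of_abc` — the CONVERSE `ABC ⟹ R4♯` modulo {modularity, Česnavičius's `|c| = 1`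
  for the semistable optimal curve, ARS 2012 Thm 2.1 (b)}, all KNOWN; with file II's `abc_of_sharpCongruenceNumberRat`
  the one-statement `sharpCongruenceNumberRat_iff_abc_of_facts : … → (SharpCongruenceNumberRat ↔ ABC)` — census row
  A0-4 = «abc-EQUIVALENT RESTATEMENT, BOTH directions kernel-typed modulo named known facts».
* §C (rung A-PS bookkeeping): `polyCongruenceNumberRat_of_polyModularDegreeRat_of_arsConjecture` (`R1(K) ⟹ R4(K + ½)`,
  CONDITIONAL on the OPEN ARS Conjecture 2.2 — labelled conditional) and
  `congruenceNumber_le_of_polyModularDegreeRat_of_squarefree` (`R1(K) ⟹ R4(K)` at square-free levels, modulo the known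
  ARS Thm 2.1 (b)): with file II's S3 (`R4 ⟹ R1`) the congruence row and the degree row are ONE row up to the excess
  `r_f/m_f` at additive primes, which is unbounded in print (ARS p. 3, `242B1`).
* §D (rung A0): with file III the sharp rows are ONE class — `sharpCongruenceNumberRat_iff_heightConjectureRat_of_facts`
  (R4♯ ⟺ R5♯, six KNOWN facts), `sharpCongruenceNumberRat_iff_degreeConjectureRat_of_facts` (R4♯ ⟺ R1♯; `⇒` also
  needs `PeterssonUpperRat` and the OPEN `PolyManinRat 0`), and the one-way edges into R4♯ from R5♯ / R1♯ (known facts).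

References: [AgasheRibetStein2012] Thm 2.1, Conj 2.2; [MurtyCongruencePrimes1999] Thm 1; [MurtyPasten2013] §4 (Conj 4.4,
Thm 4.5, p. 3748); [PastenShimura2024] §3, Rem 3.3; [Cesnavicius2018] Thm 1.2; [BCDTJAMS2001] Thm A; [Iwaniec2002] Thm 8.3.
-/

noncomputable section
namespace Summit.ABC.Analytic
open Literature.NumberTheory.EllipticCurves Literature.NumberTheory.EllipticCurves.ModularForms
open CongruenceSubgroup WeierstrassCurve
open scoped MatrixGroups ModularForm

/-! ## §A (rung A-PS) The EFFECTIVE congruence edges BY NAME: R4-Eff / R9 ⟹ `Summit.ABC.PolySzpiroRatEff` -/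

/-- **R4-Eff ⟹ A-PS-Eff by name, exponent `6K`, constant `6 log(163 C) + 24π + 16`** (census row PS-4,
EFFECTIVE cell): `PolyCongruenceNumberRatEff K C → Summit.ABC.PolySzpiroRatEff (6K) (6 log(163 C) + 24π + 16)`,
modulo the three KNOWN named facts of S3 — modularity with an integral Manin constant
(`nonempty_modularParametrizationData`, BCDT 2001 Thm A), Ribet's `m_f ∣ r_f`
(`modularDegree_dvd_congruenceNumber`, ARS 2012 Thm 2.1) and Mazur–Kenku
(`PastenShimura2024_minimalDegree_le_163_mul`). Chain: `r_f ≤ C N^K` ⟹ optimal `m_f ≤ r_f` ⟹ every globally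
minimal `W` has a datum of degree `≤ 163 C N^K` (file II `polyModularDegreeRatEff_of_optimal_bound`) ⟹ file I's
hypothesis-free S1 (`polySzpiroRatEff_of_polyModularDegreeRatEff`, trivial Petersson bound). EFFECTIVE: yes (all
constants explicit). NOT abc — «NOT abc — POLY-SZPIRO(E = 6K)» (D-0139/D-0140); typed ≠ proved: the antecedent is OPEN.
[cite: AgasheRibetStein2012, Thm. 2.1] [cite: PastenShimura2024, §3 (3.1)–(3.2) and p. 13] -/
theorem polySzpiroRatEff_of_polyCongruenceNumberRatEff {K C : ℝ} (hmod : nonempty_modularParametrizationData)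
    (hR : modularDegree_dvd_congruenceNumber) (h163 : PastenShimura2024_minimalDegree_le_163_mul)
    (h : PolyCongruenceNumberRatEff K C) :
    Summit.ABC.PolySzpiroRatEff (6 * K) (6 * Real.log (163 * C) + 24 * Real.pi + 16) := by
  have hdeg : PolyModularDegreeRatEff K (163 * C) :=
    polyModularDegreeRatEff_of_optimal_bound hmod h163 fun W₀ _ N _ D₀ hopt => by
      have hle : D₀.modularDegree ≤ congruenceNumber D₀.f :=
        Nat.le_of_dvd (congruenceNumber_pos_of_datum D₀) (hR W₀ N D₀ hopt)
      have hle' : (D₀.modularDegree : ℝ) ≤ (congruenceNumber D₀.f : ℝ) := by exact_mod_cast hle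
      exact hle'.trans (h W₀ N D₀)
  exact fun W _ => polySzpiroRatEff_of_polyModularDegreeRatEff hdeg W

/-- **R4 ⟹ A-PS-Eff with the SHARP exponent `6K − 3 + ε`** (S3 then file I's hypothesis-free S1♯, which uses the
PROVED Petersson lower bound `(f,f) ≫_η N^{1−η}`, `η > ½`, Iwaniec Thm 8.3): for every `ε > 0`,
`PolyCongruenceNumberRat K → ∃ C', Summit.ABC.PolySzpiroRatEff (6K − 3 + ε) C'`, modulo modularity, Ribet,
Mazur–Kenku. NOT abc — «NOT abc — POLY-SZPIRO(E = 6K − 3 + ε)» (D-0139/D-0140).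
[cite: AgasheRibetStein2012, Thm. 2.1] [cite: Iwaniec2002, Thm. 8.3] -/
theorem exists_polySzpiroRatEff_sharp_of_polyCongruenceNumberRat {K ε : ℝ} (hε : 0 < ε)
    (hmod : nonempty_modularParametrizationData) (hR : modularDegree_dvd_congruenceNumber)
    (h163 : PastenShimura2024_minimalDegree_le_163_mul) (h : PolyCongruenceNumberRat K) :
    ∃ C' : ℝ, Summit.ABC.PolySzpiroRatEff (6 * K - 3 + ε) C' :=
  exists_polySzpiroRatEff_sharp_of_polyModularDegreeRat hε
    (polyModularDegreeRat_of_polyCongruenceNumberRat hmod hR h163 h)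

/-- **R9 ⟹ A-PS-Eff by name, exponent `6K`, constant `6C + 6 log 163 + 24π + 16`** (Murty–Pasten 2013 Thm 4.5 in
kernel form with explicit constants): `MurtyPastenConj44 K C → Summit.ABC.PolySzpiroRatEff (6K) (6C + 6 log 163 + 24π + 16)`,
modulo modularity, Mazur–Kenku and the printed divisibility `m_f ∣ n'_f` (MP 2013 p. 3748, the unfolded hypothesis `hd`
of file II's S3′). EFFECTIVE: yes. NOT abc — «NOT abc — POLY-SZPIRO(E = 6K)» (D-0139/D-0140).
PATH-TO-ABC remark (R9-H2, refereed): Murty–Pasten themselves write "We do not know if a sufficiently strong version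
of the ABC conjecture implies Conjecture 4.4" (p. 3748, after Thm 4.5) — NO converse edge `ABC → MurtyPastenConj44` exists
in print and none is typed here; R9 is a one-way door (R9 ⟹ R1 ⟹ A-PS), unlike R4♯ (§B, a two-way restatement).
[cite: MurtyPasten2013, Conj. 4.4 and Thm. 4.5 (p. 3748)] -/
theorem polySzpiroRatEff_of_murtyPastenConj44 {K C : ℝ} (hmod : nonempty_modularParametrizationData)
    (h163 : PastenShimura2024_minimalDegree_le_163_mul)
    (hd : ∀ (W₀ : WeierstrassCurve ℚ) [W₀.IsElliptic] (N : ℕ) [NeZero N] (D₀ : ModularParametrizationData W₀ N),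
      (∀ (W' : WeierstrassCurve ℚ) [W'.IsElliptic] (D' : ModularParametrizationData W' N),
          D'.f = D₀.f → D₀.modularDegree ≤ D'.modularDegree) →
        D₀.modularDegree ∣ anemicCongruenceNumber D₀.f)
    (h : MurtyPastenConj44 K C) :
    Summit.ABC.PolySzpiroRatEff (6 * K) (6 * C + 6 * Real.log 163 + 24 * Real.pi + 16) := by
  have hdeg : PolyModularDegreeRatEff K (163 * Real.exp C) :=
    polyModularDegreeRatEff_of_optimal_bound hmod h163 fun W₀ _ N _ D₀ hopt => by
      obtain ⟨hpos, hlog⟩ := h W₀ N D₀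
      have hle : (D₀.modularDegree : ℝ) ≤ (anemicCongruenceNumber D₀.f : ℝ) := by
        exact_mod_cast Nat.le_of_dvd hpos (hd W₀ N D₀ hopt)
      have hN : (0 : ℝ) < N := by exact_mod_cast Nat.pos_of_ne_zero (NeZero.ne N)
      have ha : (0 : ℝ) < anemicCongruenceNumber D₀.f := by exact_mod_cast hpos
      exact hle.trans (le_exp_mul_rpow_of_log_le ha hN hlog)
  intro W _
  have h1 := polySzpiroRatEff_of_polyModularDegreeRatEff hdeg W
  rw [Real.log_mul (by norm_num : (163 : ℝ) ≠ 0) (Real.exp_pos C).ne', Real.log_exp] at h1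
  linarith

/-! ## §B (rung A0 FIRST) The A0-4 row is a TWO-WAY restatement of abc: `ABC → SharpCongruenceNumberRat`

File II proves `SharpCongruenceNumberRat → ABC` (`abc_of_sharpCongruenceNumberRat`, modulo modularity, Ribet,
Mazur–Kenku and the Hoffstein–Lockhart Petersson LOWER bound `1−ε`). Here is the CONVERSE, modulo KNOWN facts only:
modularity (`nonempty_modularParametrizationData`; it yields the optimal datum on a GLOBALLY MINIMAL model because
Edixhoven's integrality is a theorem of the tree, `exists_optimal_modularParametrizationData_of_modularity`), the Manin
constant `|c| = 1` of the semistable optimal curve (the tree's named-fact schema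
`ModularParametrizationData.abs_maninConstant_eq_one_of_isSemistable`; Mazur 1978, Abbes–Ullmo 1996, Česnavičius 2018
Thm 1.2) and Agashe–Ribet–Stein 2012 Thm 2.1 (b) `ord_p(r_E) = ord_p(m_E)` for `p² ∤ N` (named fact
`padicValNat_congruenceNumber_eq_of_not_sq_dvd`). The analytic input of this direction — the Petersson UPPER bound at
square-free level `(f,f) ≤ C · N · (1 + log N)⁵` — and everything else (abc ⟹ generalised Szpiro, Bombieri–Gubler
12.5.12; Silverman's lower covolume inequality; Zagier's identity; Carayol's theorem at square-free level) are
PROVED in the tree (`modularDegree_le_maninSq_of_abcLe_of_isSemistable'`, Murty 1999 Thm 1 (ii) run on every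
semistable curve). So the census row A0-4 reads: «abc-EQUIVALENT RESTATEMENT — BOTH directions kernel-typed, each
modulo named KNOWN facts; no direction is print-only». abc is NOT proved by any of this. -/

/-- **A0-4 converse: `ABC ⟹ SharpCongruenceNumberRat`** (`r_f ≤ C(ε) · N^{2+ε}` for the newform of every elliptic
`W/ℚ` at square-free level), modulo three KNOWN named facts: modularity (`hmod`), `|c| = 1` for the optimal curve of a
semistable class (`hc1`, Česnavičius 2018 Thm 1.2, the tree's schema `abs_maninConstant_eq_one_of_isSemistable`) and
ARS 2012 Thm 2.1 (b) (`hARS`). Proof: a datum at square-free level `N` has `N = N_W` and `W` semistable (Carayol's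
square-free case, PROVED); modularity gives the optimal datum `D₀` of the class on a globally minimal `W₀`, with
`|c₀| = 1`; abc gives `deg D₀ ≤ C · c₀² · N^{2+ε}` (`modularDegree_le_maninSq_of_abcLe_of_isSemistable'`: generalised
Szpiro + Silverman + Zagier + the PROVED square-free Petersson upper bound); and `r_f = deg D₀ = m_f` because
`ord_p(r_f) = ord_p(m_f)` at EVERY prime when `N` is squarefree. Murty 1999 Thm 1 (ii) in congruence clothing, for all
semistable curves rather than Frey curves. abc is NOT proved: this is the direction FROM the summit.
[cite: MurtyCongruencePrimes1999, Thm. 1 (ii) and §2] [cite: AgasheRibetStein2012, Thm. 2.1]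
[cite: Cesnavicius2018, Thm. 1.2] [cite: PastenShimura2024, Rem. 3.3] -/
theorem sharpCongruenceNumberRat_of_abc (hmod : nonempty_modularParametrizationData)
    (hc1 : ∀ {N : ℕ} [NeZero N] {W₀ : WeierstrassCurve ℚ} (D₀ : ModularParametrizationData W₀ N),
      D₀.abs_maninConstant_eq_one_of_isSemistable)
    (hARS : padicValNat_congruenceNumber_eq_of_not_sq_dvd) (habc : ABC) : SharpCongruenceNumberRat := by
  -- abc in `≤`-form, the currency of the Literature theorems
  have hle : ∀ ε : ℝ, 0 < ε → ∃ C : ℝ, ∀ a b c : ℕ,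
      Literature.NumberTheory.DiophantineGeometry.IsABCTriple a b c →
        (c : ℝ) ≤ C * ((Literature.NumberTheory.DiophantineGeometry.rad a b c : ℕ) : ℝ) ^ (1 + ε) := by
    intro ε hε
    obtain ⟨C, -, hC⟩ := (ABC_iff.mp habc) ε hε
    exact ⟨C, fun a b c h => (hC a b c h).le⟩
  -- modularity ⟹ the optimal datum of each class lives on a GLOBALLY MINIMAL model (Edixhoven, a tree theorem)
  have hOpt : Literature.NumberTheory.Automorphic.exists_optimal_modularParametrizationData :=
    Literature.NumberTheory.Automorphic.exists_optimal_modularParametrizationData_of_modularity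
      (exists_isNewformOf_of_nonempty_modularParametrizationData hmod)
  intro ε hε
  obtain ⟨C, hC⟩ := modularDegree_le_maninSq_of_abcLe_of_isSemistable' hle ε hε
  refine ⟨C, fun W _ N _ D hsq => ?_⟩
  -- a global minimal model `Cv • W`, same newform, and `N = N_W` (Carayol, square-free case, PROVED)
  obtain ⟨Cv, hV⟩ := hasGlobalMinimalModel_rat_holds W
  haveI := hV
  have hfV : IsNewformOf (Cv • W) D.f :=
    ⟨D.isNewformOf.1, fun n => by rw [D.isNewformOf.2 n, WeierstrassCurve.LFunction_smul]⟩
  have hNV : N = (Cv • W).conductorNorm ℤ := hfV.level_eq_conductorNorm_of_squarefree_level hsq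
  -- the optimal datum `D₀` of the class of `D.f`, on a globally minimal `W₀`
  obtain ⟨W₀, hW₀, hW₀min, D₀, hfW₀, -, hmin₀⟩ := hOpt N (Cv • W) hNV.symm
  haveI := hW₀
  haveI := hW₀min
  have hf : D.f = D₀.f := hfV.unique hfW₀
  have hss₀ : W₀.IsSemistable ℤ := D₀.isNewformOf.isSemistable_of_squarefree_level hsq
  have hN₀ : N = W₀.conductorNorm ℤ := D₀.isNewformOf.level_eq_conductorNorm_of_squarefree_level hsq
  -- Česnavičius: `|c₀| = 1`
  have hc : |D₀.maninConstant| = 1 := hc1 D₀ hss₀ hmin₀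
  have hc2 : (D₀.maninConstant : ℝ) ^ 2 = 1 := by
    have h1 : ((|D₀.maninConstant| : ℤ) : ℝ) = 1 := by exact_mod_cast hc
    rw [Int.cast_abs] at h1
    rw [← sq_abs, h1, one_pow]
  -- abc at the optimal datum: `deg D₀ ≤ C · 1 · N^{2+ε}`
  have hdeg₀ := hC W₀ N hN₀.symm hss₀ D₀
  rw [hc2, mul_one] at hdeg₀
  -- ARS Thm 2.1 (b) at EVERY prime (`N` squarefree): `r_f = deg D₀ (= m_f)`
  have hr0 : congruenceNumber D₀.f ≠ 0 := (congruenceNumber_pos_of_datum D₀).ne'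
  have hm0 : D₀.modularDegree ≠ 0 := D₀.deg_pos.ne'
  have hr : congruenceNumber D₀.f = D₀.modularDegree := by
    refine (Nat.eq_iff_prime_padicValNat_eq _ _ hr0 hm0).mpr fun p hp => ?_
    exact hARS W₀ N D₀ hmin₀ p hp fun hp2 =>
      Nat.squarefree_iff_prime_squarefree.mp hsq p hp (by simpa [sq] using hp2)
  rw [hf, hr]
  exact hdeg₀

/-- **A0-4 = abc, both ways, in ONE statement**: `SharpCongruenceNumberRat ↔ ABC` modulo exactly the named KNOWN
facts {modularity `nonempty_modularParametrizationData`; Ribet `modularDegree_dvd_congruenceNumber`; Mazur–Kenku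
`PastenShimura2024_minimalDegree_le_163_mul`; Hoffstein–Lockhart's Petersson lower bound
`murty_petersson_newform_lower_bound` (for `⇒`, file II); Česnavičius `abs_maninConstant_eq_one_of_isSemistable` and
ARS Thm 2.1 (b) `padicValNat_congruenceNumber_eq_of_not_sq_dvd` (for `⇐`, above)}. The sharp congruence-number
conjecture at square-free level is a RESTATEMENT of the abc conjecture (Murty 1999 Thm 1 for the semistable class, in
adjoint-Selmer / congruence-module clothing: `r_E` is the order of `𝕋/(I_f + Ann I_f)`), NOT a door to it; labelled so
for the census. abc is NOT proved by any of this. [cite: MurtyCongruencePrimes1999, Thm. 1]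
[cite: AgasheRibetStein2012, Thm. 2.1] [cite: Cesnavicius2018, Thm. 1.2] -/
theorem sharpCongruenceNumberRat_iff_abc_of_facts (hmod : nonempty_modularParametrizationData)
    (hR : modularDegree_dvd_congruenceNumber) (h163 : PastenShimura2024_minimalDegree_le_163_mul)
    (hP : murty_petersson_newform_lower_bound)
    (hc1 : ∀ {N : ℕ} [NeZero N] {W₀ : WeierstrassCurve ℚ} (D₀ : ModularParametrizationData W₀ N),
      D₀.abs_maninConstant_eq_one_of_isSemistable)
    (hARS : padicValNat_congruenceNumber_eq_of_not_sq_dvd) : SharpCongruenceNumberRat ↔ ABC :=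
  ⟨abc_of_sharpCongruenceNumberRat hmod hR h163 hP, sharpCongruenceNumberRat_of_abc hmod hc1 hARS⟩

/-- **Consequently A-PS follows from R4♯ too** (through the summit: R4♯ ⟹ `ABC` ⟹ Szpiro `6+ε` ⟹ A-PS with `K = 7`,
`Summit.ABC.polySzpiroRat_of_abc`), modulo the four named facts of the `⇒` direction — recorded only to make the
obligation graph explicit: the A0 row dominates the A-PS rung. NOT abc is claimed; A-PS is «NOT abc — POLY-SZPIRO(E)».
[cite: MurtyCongruencePrimes1999, Thm. 1 (i)] [cite: SilvermanAEC2009, Prop. VIII.11.5(b)] -/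
theorem polySzpiroRat_of_sharpCongruenceNumberRat (hmod : nonempty_modularParametrizationData)
    (hR : modularDegree_dvd_congruenceNumber) (h163 : PastenShimura2024_minimalDegree_le_163_mul)
    (hP : murty_petersson_newform_lower_bound) (h : SharpCongruenceNumberRat) : Summit.ABC.PolySzpiroRat :=
  Summit.ABC.polySzpiroRat_of_abc (abc_of_sharpCongruenceNumberRat hmod hR h163 hP h)

/-! ## §C (rung A-PS) Closing the R1 ⟷ R4 circle at the polynomial level: R1 ⟹ R4 modulo ARS 2012

File II's S3 is `R4(K) ⟹ R1(K)` modulo Ribet / modularity / Mazur–Kenku. The reverse edge needs control of the EXCESS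
`r_f / m_f`, supported on the primes `p² ∣ N` (ARS 2012 Thm 2.1 (b)); in print there is NO uniform bound («It is unclear
whether there is a bound on the possible primes p that occur», ARS p. 3; `242B1`), only the OPEN Conjecture 2.2
`ord_p(r_E/m_E) ≤ ½ ord_p(N)` (verified for `N ≤ 557`; tree `AgasheRibetStein2012_conjecture`, `@[conjecture]`). So:
`R1(K) ⟹ R4(K + ½)` CONDITIONALLY on ARS Conj 2.2 (open — this edge is conditional, labelled so), and `R1(K) ⟹ R4(K)`
UNCONDITIONALLY at square-free levels (modulo the known Thm 2.1 (b)). Neither is abc; both are A-PS bookkeeping. -/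

/-- **R1 ⟹ R4 with exponent `K + ½`, CONDITIONAL on the OPEN Agashe–Ribet–Stein Conjecture 2.2** (`hARS2`,
`2 ord_p(r) ≤ 2 ord_p(m) + ord_p(N)` for the optimal datum; NOT a known fact — this theorem is a conditional edge) and
nothing else: `PolyModularDegreeRat K → PolyCongruenceNumberRat (K + ½)`. For a datum `D` of `W` at level `N`: R1 gives
a datum `D_V` of the global minimal model `V = Cv • W` at level `N_V` with `deg D_V ≤ C N_V^K`; `N = N_V` (two newforms of
one curve have one level, `IsNewformOf.level_eq_level`, PROVED) and `D_V.f = D.f`; the optimal datum `D₀` of the class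
has `m_f = deg D₀ ≤ deg D_V`; and Conj 2.2 primewise gives `r_f² ∣ m_f² N`, i.e. `r_f ≤ m_f √N ≤ C N^{K+½}`. With S3 this
makes R4 and R1 the SAME row up to `½` in the exponent — modulo an open conjecture; unconditionally only R4 ⟹ R1.
NOT abc — «NOT abc — POLY-SZPIRO(E)» bookkeeping (D-0139/D-0140). [cite: AgasheRibetStein2012, Conj. 2.2 and Thm. 2.1] -/
theorem polyCongruenceNumberRat_of_polyModularDegreeRat_of_arsConjecture {K : ℝ}
    (hARS2 : AgasheRibetStein2012_conjecture) (h : PolyModularDegreeRat K) :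
    PolyCongruenceNumberRat (K + 1 / 2) := by
  obtain ⟨C, hC⟩ := h
  refine ⟨max C 0, fun W _ N _ D => ?_⟩
  -- the global minimal model `V = Cv • W` and its R1-datum `DV` at level `N_V`
  obtain ⟨Cv, hV⟩ := hasGlobalMinimalModel_rat_holds W
  haveI := hV
  haveI : NeZero ((Cv • W).conductorNorm ℤ) := ⟨(conductorNorm_pos_holds (Cv • W)).ne'⟩
  obtain ⟨DV, hDV⟩ := hC (Cv • W)
  have hfV : IsNewformOf (Cv • W) D.f :=
    ⟨D.isNewformOf.1, fun n => by rw [D.isNewformOf.2 n, WeierstrassCurve.LFunction_smul]⟩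
  -- one curve, one level: `N = N_V`
  have hNV : (Cv • W).conductorNorm ℤ = N := (hfV.level_eq_level DV.isNewformOf).symm
  subst hNV
  have hf : DV.f = D.f := DV.isNewformOf.unique hfV
  -- the optimal datum `D₀` of the class: `m_f = deg D₀ ≤ deg DV ≤ C N^K`
  obtain ⟨W₀, _, D₀, hf₀, hmin₀⟩ := Pasten2024.exists_minimal_datum_in_class D
  have hm : D₀.modularDegree ≤ DV.modularDegree := hmin₀ _ DV (hf.trans hf₀.symm)
  set Nn : ℕ := (Cv • W).conductorNorm ℤ with hNn
  have hN0 : Nn ≠ 0 := NeZero.ne Nn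
  have hNpos : (0 : ℝ) < (Nn : ℝ) := by exact_mod_cast Nat.pos_of_ne_zero hN0
  -- ARS Conj 2.2 primewise: `r² ∣ m₀² N`
  set r := congruenceNumber D₀.f with hr
  set m := D₀.modularDegree with hmdef
  have hr0 : r ≠ 0 := (congruenceNumber_pos_of_datum D₀).ne'
  have hm0 : m ≠ 0 := D₀.deg_pos.ne'
  have hv := hARS2 W₀ Nn D₀ hmin₀
  have hdvd : r ^ 2 ∣ m ^ 2 * Nn := by
    rw [← Nat.factorization_le_iff_dvd (pow_ne_zero 2 hr0) (mul_ne_zero (pow_ne_zero 2 hm0) hN0),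
      Nat.factorization_pow, Nat.factorization_mul (pow_ne_zero 2 hm0) hN0, Nat.factorization_pow]
    intro p
    by_cases hp : p.Prime
    · simp only [Finsupp.smul_apply, Finsupp.add_apply, smul_eq_mul, Nat.factorization_def _ hp]
      exact hv p hp
    · simp [Nat.factorization_eq_zero_of_not_prime _ hp]
  have hle : r ^ 2 ≤ m ^ 2 * Nn :=
    Nat.le_of_dvd (Nat.pos_of_ne_zero (mul_ne_zero (pow_ne_zero 2 hm0) hN0)) hdvd
  have hle' : ((r : ℝ)) ^ 2 ≤ ((m : ℝ) * (Nn : ℝ) ^ (1 / 2 : ℝ)) ^ 2 := by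
    have h1 : ((r : ℝ)) ^ 2 ≤ ((m : ℝ)) ^ 2 * (Nn : ℝ) := by exact_mod_cast hle
    have h2 : ((Nn : ℝ) ^ (1 / 2 : ℝ)) ^ 2 = (Nn : ℝ) := by
      rw [← Real.rpow_natCast, ← Real.rpow_mul hNpos.le]; norm_num
    rw [mul_pow, h2]; exact h1
  have hrle : (r : ℝ) ≤ (m : ℝ) * (Nn : ℝ) ^ (1 / 2 : ℝ) :=
    (pow_le_pow_iff_left₀ (by positivity) (by positivity) two_ne_zero).mp hle'
  -- assemble: `r_f = r_{D₀.f} ≤ m √N ≤ deg DV · √N ≤ C N^K √N ≤ max C 0 · N^{K+½}`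
  have hmR : (m : ℝ) ≤ (DV.modularDegree : ℝ) := by exact_mod_cast hm
  have hsqrt0 : (0 : ℝ) ≤ (Nn : ℝ) ^ (1 / 2 : ℝ) := by positivity
  have hNK : (0 : ℝ) ≤ (Nn : ℝ) ^ K := by positivity
  have hsplit : (Nn : ℝ) ^ K * (Nn : ℝ) ^ (1 / 2 : ℝ) = (Nn : ℝ) ^ (K + 1 / 2) := by
    rw [← Real.rpow_add hNpos]
  rw [← hf₀]
  calc ((congruenceNumber D₀.f : ℕ) : ℝ) = (r : ℝ) := by rw [hr]
    _ ≤ (m : ℝ) * (Nn : ℝ) ^ (1 / 2 : ℝ) := hrle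
    _ ≤ (DV.modularDegree : ℝ) * (Nn : ℝ) ^ (1 / 2 : ℝ) := by gcongr
    _ ≤ (C * (Nn : ℝ) ^ K) * (Nn : ℝ) ^ (1 / 2 : ℝ) := by gcongr
    _ ≤ (max C 0 * (Nn : ℝ) ^ K) * (Nn : ℝ) ^ (1 / 2 : ℝ) := by gcongr; exact le_max_left _ _
    _ = max C 0 * (Nn : ℝ) ^ (K + 1 / 2) := by rw [mul_assoc, hsplit]

/-- **R1 ⟹ R4 at SQUARE-FREE levels with the SAME exponent `K`, unconditionally modulo the KNOWN ARS 2012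
Thm 2.1 (b)** (`hARS`, `ord_p(r_E) = ord_p(m_E)` for `p² ∤ N`): `PolyModularDegreeRat K` gives `C` with `r_f ≤ C · N^K`
for the newform of every elliptic `W/ℚ` at square-free level `N` — there `r_f = m_f` (every prime has `p² ∤ N`), and
`m_f ≤ deg D_V ≤ C N_V^K` for the R1-datum `D_V` of the global minimal model (`N = N_V`, `IsNewformOf.level_eq_level`).
This is the R4-idiom restatement of R1 for semistable curves (no excess); it is NOT the full R4 (additive levels carry
the excess `r/m`). NOT abc — «NOT abc — POLY-SZPIRO(E)» bookkeeping. [cite: AgasheRibetStein2012, Thm. 2.1] -/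
theorem congruenceNumber_le_of_polyModularDegreeRat_of_squarefree {K : ℝ}
    (hARS : padicValNat_congruenceNumber_eq_of_not_sq_dvd) (h : PolyModularDegreeRat K) :
    ∃ C : ℝ, ∀ (W : WeierstrassCurve ℚ) [W.IsElliptic] (N : ℕ) [NeZero N] (D : ModularParametrizationData W N),
      Squarefree N → (congruenceNumber D.f : ℝ) ≤ C * (N : ℝ) ^ K := by
  obtain ⟨C, hC⟩ := h
  refine ⟨C, fun W _ N _ D hsq => ?_⟩
  obtain ⟨Cv, hV⟩ := hasGlobalMinimalModel_rat_holds W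
  haveI := hV
  haveI : NeZero ((Cv • W).conductorNorm ℤ) := ⟨(conductorNorm_pos_holds (Cv • W)).ne'⟩
  obtain ⟨DV, hDV⟩ := hC (Cv • W)
  have hfV : IsNewformOf (Cv • W) D.f :=
    ⟨D.isNewformOf.1, fun n => by rw [D.isNewformOf.2 n, WeierstrassCurve.LFunction_smul]⟩
  have hNV : (Cv • W).conductorNorm ℤ = N := (hfV.level_eq_level DV.isNewformOf).symm
  subst hNV
  have hf : DV.f = D.f := DV.isNewformOf.unique hfV
  obtain ⟨W₀, _, D₀, hf₀, hmin₀⟩ := Pasten2024.exists_minimal_datum_in_class D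
  have hm : D₀.modularDegree ≤ DV.modularDegree := hmin₀ _ DV (hf.trans hf₀.symm)
  -- `r_f = m_f` primewise at square-free level
  have hr0 : congruenceNumber D₀.f ≠ 0 := (congruenceNumber_pos_of_datum D₀).ne'
  have hm0 : D₀.modularDegree ≠ 0 := D₀.deg_pos.ne'
  have hr : congruenceNumber D₀.f = D₀.modularDegree := by
    refine (Nat.eq_iff_prime_padicValNat_eq _ _ hr0 hm0).mpr fun p hp => ?_
    exact hARS W₀ _ D₀ hmin₀ p hp fun hp2 =>
      Nat.squarefree_iff_prime_squarefree.mp hsq p hp (by simpa [sq] using hp2)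
  rw [← hf₀, hr]
  calc (D₀.modularDegree : ℝ) ≤ (DV.modularDegree : ℝ) := by exact_mod_cast hm
    _ ≤ C * (((Cv • W).conductorNorm ℤ : ℕ) : ℝ) ^ K := hDV

/-! ## §D (rung A0) The sharp rows are ONE equivalence class: R4♯ ⟺ R5♯ ⟺ R1♯ ⟺ `ABC` modulo named facts

With file III (`Summits/ABC/Analytic/RequirementsSharp.lean`: `abc_iff_heightConjectureRat` unconditional,
`abc_iff_degreeConjectureRat_of_facts`) the A0 block of the table closes into one class in the kernel. The edges INTO R4♯
(from R5♯, from R1♯, from `ABC`) are modulo KNOWN facts only; the edge R4♯ ⟹ R1♯ (all `E/ℚ`) additionally needs a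
general-level Petersson upper bound (known in print, not yet in the tree) and UNIFORMLY bounded Manin constants
(`PolyManinRat 0`, OPEN off the semistable case) — exactly Murty's direction (ii) inputs (Pasten 2024 Rem. 3.3). All of these
are RESTATEMENT certificates: abc is NOT proved by any of this. -/

/-- **R5♯ ⟹ R4♯ modulo KNOWN facts only** {modularity, Česnavičius `|c| = 1`, ARS Thm 2.1 (b)}: the sharp height
conjecture gives `ABC` unconditionally (file III `abc_of_heightConjectureRat`: Silverman 1986 + Bombieri–Gubler 12.5.12,
PROVED) and then §B applies. [cite: Frey1989] [cite: AgasheRibetStein2012, Thm. 2.1] -/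
theorem sharpCongruenceNumberRat_of_heightConjectureRat (hmod : nonempty_modularParametrizationData)
    (hc1 : ∀ {N : ℕ} [NeZero N] {W₀ : WeierstrassCurve ℚ} (D₀ : ModularParametrizationData W₀ N),
      D₀.abs_maninConstant_eq_one_of_isSemistable)
    (hARS : padicValNat_congruenceNumber_eq_of_not_sq_dvd) (h : HeightConjectureRat) : SharpCongruenceNumberRat :=
  sharpCongruenceNumberRat_of_abc hmod hc1 hARS (abc_of_heightConjectureRat h)

/-- **R4♯ ⟹ R5♯ modulo KNOWN facts only** {modularity, Ribet, Mazur–Kenku, Hoffstein–Lockhart}: file II's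
`abc_of_sharpCongruenceNumberRat` followed by file III's unconditional `heightConjectureRat_of_abc`.
[cite: MurtyCongruencePrimes1999, Thm. 1 (i)] [cite: BombieriGubler2006, Thm. 12.5.12] -/
theorem heightConjectureRat_of_sharpCongruenceNumberRat (hmod : nonempty_modularParametrizationData)
    (hR : modularDegree_dvd_congruenceNumber) (h163 : PastenShimura2024_minimalDegree_le_163_mul)
    (hP : murty_petersson_newform_lower_bound) (h : SharpCongruenceNumberRat) : HeightConjectureRat :=
  heightConjectureRat_of_abc (abc_of_sharpCongruenceNumberRat hmod hR h163 hP h)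

/-- **R4♯ ⟺ R5♯** (the sharp congruence-number conjecture at square-free level ⟺ Frey's sharp height conjecture for
all `E/ℚ`) modulo the SIX named KNOWN facts of `sharpCongruenceNumberRat_iff_abc_of_facts` — no open input on either
side. A restatement certificate. [cite: MurtyCongruencePrimes1999, Thm. 1] [cite: Frey1989] -/
theorem sharpCongruenceNumberRat_iff_heightConjectureRat_of_facts (hmod : nonempty_modularParametrizationData)
    (hR : modularDegree_dvd_congruenceNumber) (h163 : PastenShimura2024_minimalDegree_le_163_mul)
    (hP : murty_petersson_newform_lower_bound)
    (hc1 : ∀ {N : ℕ} [NeZero N] {W₀ : WeierstrassCurve ℚ} (D₀ : ModularParametrizationData W₀ N),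
      D₀.abs_maninConstant_eq_one_of_isSemistable)
    (hARS : padicValNat_congruenceNumber_eq_of_not_sq_dvd) : SharpCongruenceNumberRat ↔ HeightConjectureRat :=
  (sharpCongruenceNumberRat_iff_abc_of_facts hmod hR h163 hP hc1 hARS).trans abc_iff_heightConjectureRat

/-- **R1♯ ⟹ R4♯ modulo KNOWN facts only** {Hoffstein–Lockhart, modularity, Česnavičius, ARS Thm 2.1 (b)}: the sharp
degree conjecture for all `E/ℚ` gives `ABC` (file II `abc_of_degreeConjectureRat`) and then §B. So the congruence row
R4♯ is implied by each of the other sharp rows through known facts. [cite: MurtyCongruencePrimes1999, Thm. 1]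
[cite: AgasheRibetStein2012, Thm. 2.1] -/
theorem sharpCongruenceNumberRat_of_degreeConjectureRat (hP : murty_petersson_newform_lower_bound)
    (hmod : nonempty_modularParametrizationData)
    (hc1 : ∀ {N : ℕ} [NeZero N] {W₀ : WeierstrassCurve ℚ} (D₀ : ModularParametrizationData W₀ N),
      D₀.abs_maninConstant_eq_one_of_isSemistable)
    (hARS : padicValNat_congruenceNumber_eq_of_not_sq_dvd) (h : DegreeConjectureRat) : SharpCongruenceNumberRat :=
  sharpCongruenceNumberRat_of_abc hmod hc1 hARS (abc_of_degreeConjectureRat hP h)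

/-- **R4♯ ⟺ R1♯ modulo named facts** — the six KNOWN facts of `sharpCongruenceNumberRat_iff_abc_of_facts` plus, for
`⇒` only (R4♯ ⟹ `ABC` ⟹ degree conjecture for ALL `E/ℚ`, file III `degreeConjectureRat_of_abc`), a general-level
Petersson UPPER bound for every `θ > 0` (`hU`, known in print, a formal debt) and UNIFORMLY bounded Manin constants
(`hM : PolyManinRat 0`, OPEN in general — this iff is therefore conditional on an open input in that one place, labelled
so). Murty 1999 Thm 1 with Pasten's Manin caveat, congruence side. [cite: MurtyCongruencePrimes1999, Thm. 1]
[cite: PastenShimura2024, Rem. 3.3] -/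
theorem sharpCongruenceNumberRat_iff_degreeConjectureRat_of_facts (hmod : nonempty_modularParametrizationData)
    (hR : modularDegree_dvd_congruenceNumber) (h163 : PastenShimura2024_minimalDegree_le_163_mul)
    (hP : murty_petersson_newform_lower_bound)
    (hc1 : ∀ {N : ℕ} [NeZero N] {W₀ : WeierstrassCurve ℚ} (D₀ : ModularParametrizationData W₀ N),
      D₀.abs_maninConstant_eq_one_of_isSemistable)
    (hARS : padicValNat_congruenceNumber_eq_of_not_sq_dvd) (hU : ∀ θ : ℝ, 0 < θ → PeterssonUpperRat θ)
    (hM : PolyManinRat 0) : SharpCongruenceNumberRat ↔ DegreeConjectureRat :=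
  (sharpCongruenceNumberRat_iff_abc_of_facts hmod hR h163 hP hc1 hARS).trans
    (abc_iff_degreeConjectureRat_of_facts hP hmod hU hM)

end Summit.ABC.Analytic
end
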